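import Literature.IUT.HodgeArakelov.TemperedThetaMonoidsProofs

/-!
# [IUTchII] §3, Prop 3.1 (ii) — the constant monoid `Ψ_cns(M^Θ_*)` as the image of an equivariant Kummer
# embedding (third proof companion of `TemperedThetaMonoids.lean`, GENERIC form; abc-iut cell, layer L6)

S. Mochizuki, *Inter-universal Teichmüller theory II*, §3, Proposition 3.1 (ii) p. 88 [cite: Mochizuki2012,
Prop 3.1 (ii) p.88]: "By applying the cyclotomic rigidity isomorphisms of Corollaries 2.8, (i); 2.9 … one
obtains a functorial algorithm `M^Θ_* ↦ Ψ_cns(M^Θ_*) := M_TM(M^Θ_*) ⊆ lim_J H¹(Π_Ÿ(M^Θ_*)|_J, Π_μ(M^Θ_*))` for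
constructing a 'monoid of constants' — i.e., which is naturally isomorphic to `O^▷_{F̄_v}` [cf. Example 1.8,
(ii)] — equipped with a natural conjugation action by `Π_X(M^Θ_*)`."  Claim key DISPUTED (D-0012);
PROOF-ONLY (no definitions); node **IUTchII:Prop3.1(ii)**; nothing here takes a side on [IUTchIII] Cor 3.12.

RELATION TO THE FILE OF RECORD.  `TemperedThetaMonoidsProofs2.lean` (abc-iut-w4-d019, p411800; L6-lead
§F RULINGS v1.8 (1)) proves the clause in transport form over a Kummer map PINNED to the [AbsTopIII]
INTERFACE of Example 1.8 (ii) (`κ : A.MTM Pc →* E.H`, `A : AbsTopMonoids S`).  THIS FILE re-files (per that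
ruling: "the theorems that are missing and that someone needs") the GENERIC form over ANY monoid-with-action
`(O, ρ)` and ANY homomorphism `κ : O →* E.H` — the shape that the REAL model instantiates: abc-iut-w4-d007's
`MonoidKummerEquivariantModel.lean` (GAP-LEDGER G-w4d019-1) supplies, for the [AbsTopIII] Def. 3.1 (i) model
`(Π_k ↷ 𝒪_k̄^▷)`, a commutative GROUP `H = Multiplicative (lim→_N H¹(ε_k⁻¹N, Λ(k̄ˣ)))` with a `Π_k`-ACTION
`Π_k →* MulAut H` and an INJECTIVE, EQUIVARIANT `κ : 𝒪_k̄^▷ →* H` built from Mathlib group cohomology — i.e.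
`O := 𝒪_k̄^▷` is NOT an interface there, so the interface-pinned form does not apply but this one does (with
`hinj`, `hequiv` THEOREMS of that file and `hrange` the definition `constants := mrange κ`).

PROVED (elementary algebra over abc-iut-L6-t2's `ThetaEnvData`):
* `constants_stable_of_equivariant_mrange` — `Prop31Statements.constants_stable` from an equivariant `κ` with
  `mrange κ = constants`;
* `exists_constantMonoid_mulEquiv`, `constantMonoid_mulEquiv_equivariant`, `constantMonoid_mulEquiv_unique` —
  "naturally isomorphic to `O` … equipped with a natural conjugation action" (existence, equivariance,
  uniqueness of `O ⥲ Ψ_cns` commuting with `κ`); `kummer_mem_units_iff` — `M^×_TM` ↔ units of `O`;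
* `prop31Statements_of_kummer` — the first companion's `prop31Statements_of_val` with its stability
  hypothesis replaced by the Kummer mechanism;
* `constants_stable_transport`, `exists_constantMonoid_mulEquiv_transport` — the same after composing `κ`
  with an EQUIVARIANT isomorphism of ambient modules `φ : H₀ ⥲ H` ("applying the cyclotomic rigidity
  isomorphisms of Corollaries 2.8, (i); 2.9": the change of coefficient cyclotome induces such a `φ`).
-/

namespace Literature.IUT.HodgeArakelov

namespace TemperedThetaMonoids

universe u v w w'

/-! ### 1. Abstract: the constant monoid as the image of an equivariant Kummer embedding -/

section KummerImage

variable {P : Type u} [Group P] (E : ThetaEnvData.{u, v} P)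
variable {O : Type w} [CommMonoid O] (ρ : P →* MulAut O) (κ : O →* E.H)

/-- **IUTchII:Prop3.1(ii)** (kurims p.88) "equipped with a natural conjugation action by `Π_X(M^Θ_*)`":
if the constant monoid `Ψ_cns = M_TM` is the image of a `Π_X`-EQUIVARIANT homomorphism `κ : O →* H`
(the Kummer map of `O^▷_{F̄_v}` with its `Π_v`-action, Example 1.8 (ii), composed with the cyclotomic
rigidity isomorphism of the ambient module), then `Ψ_cns` is stable under the conjugation action — the
typed field `Prop31Statements.constants_stable` DISCHARGED from the printed mechanism.
[cite: Mochizuki2012, Prop 3.1 (ii) p.88] -/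
theorem constants_stable_of_equivariant_mrange (hrange : MonoidHom.mrange κ = E.constants)
    (hequiv : ∀ (g : P) (x : O), κ (ρ g x) = E.conj g (κ x)) : E.IsConjStable E.constantMonoid := by
  intro g y hy
  change y ∈ E.constants at hy
  change E.conj g y ∈ E.constants
  rw [← hrange] at hy ⊢
  obtain ⟨x, rfl⟩ := hy
  exact ⟨ρ g x, hequiv g x⟩

/-- **IUTchII:Prop3.1(ii)** (kurims p.88) "a 'monoid of constants' — i.e., which is naturally isomorphic
to `O^▷_{F̄_v}`": if `Ψ_cns` is the image of an INJECTIVE homomorphism `κ : O →* H`, then there is an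
isomorphism of monoids `O ⥲ Ψ_cns` which is `κ` on underlying elements (naturality).
[cite: Mochizuki2012, Prop 3.1 (ii) p.88] -/
theorem exists_constantMonoid_mulEquiv (hinj : Function.Injective κ)
    (hrange : MonoidHom.mrange κ = E.constants) :
    ∃ e : O ≃* E.constantMonoid, ∀ x : O, ((e x : E.constantMonoid) : E.H) = κ x :=
  have hbij : Function.Bijective κ.mrangeRestrict :=
    ⟨fun _ _ h => hinj (congrArg Subtype.val h), κ.mrangeRestrict_surjective⟩
  ⟨(MulEquiv.ofBijective κ.mrangeRestrict hbij).trans (MulEquiv.submonoidCongr hrange), fun _ => rfl⟩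

/-- **IUTchII:Prop3.1(ii)** (kurims p.88) "… equipped with a natural conjugation action by `Π_X(M^Θ_*)`":
the natural isomorphism `O ⥲ Ψ_cns` (any isomorphism that is `κ` on elements) intertwines the
`Π_X`-action on `O` with the conjugation action on `Ψ_cns`, as soon as `κ` is equivariant.
[cite: Mochizuki2012, Prop 3.1 (ii) p.88] -/
theorem constantMonoid_mulEquiv_equivariant (hequiv : ∀ (g : P) (x : O), κ (ρ g x) = E.conj g (κ x))
    (e : O ≃* E.constantMonoid) (he : ∀ x : O, ((e x : E.constantMonoid) : E.H) = κ x) (g : P) (x : O) :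
    ((e (ρ g x) : E.constantMonoid) : E.H) = E.conj g ((e x : E.constantMonoid) : E.H) := by
  rw [he, he, hequiv]

/-- **IUTchII:Prop3.1(ii)** (kurims p.88) "naturally isomorphic": the isomorphism `O ⥲ Ψ_cns` commuting
with the Kummer embedding `κ` is UNIQUE. [cite: Mochizuki2012, Prop 3.1 (ii) p.88] -/
theorem constantMonoid_mulEquiv_unique (e e' : O ≃* E.constantMonoid)
    (he : ∀ x : O, ((e x : E.constantMonoid) : E.H) = κ x)
    (he' : ∀ x : O, ((e' x : E.constantMonoid) : E.H) = κ x) : e = e' :=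
  MulEquiv.ext fun x => Subtype.ext ((he x).trans (he' x).symm)

/-- **IUTchII:Prop3.1(ii)** (kurims p.88): under the same hypotheses the unit group `M^×_TM` of the
constant monoid corresponds to the invertible elements of `O` (units of `O^▷_{F̄_v}` = `O^×_{F̄_v}`): an
element `κ x ∈ Ψ_cns` lies in `M^×_TM` iff `x` is a unit of `O`.
[cite: Mochizuki2012, Prop 3.1 (ii) p.88] -/
theorem kummer_mem_units_iff (hinj : Function.Injective κ)
    (hrange : MonoidHom.mrange κ = E.constants) (x : O) : κ x ∈ E.units ↔ IsUnit x := by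
  obtain ⟨e, he⟩ := exists_constantMonoid_mulEquiv E κ hinj hrange
  rw [← he x, ← isUnit_constantMonoid_iff E (e x)]
  exact isUnit_map_iff e x

/-- **IUTchII:Prop3.1(ii)** (kurims p.88): consequently the unit group `M^×_TM(M^Θ_*)` of the statement file
IS the Kummer image of the units of `O` ("`O^×_{F̄_v} ⊆ O^▷_{F̄_v}`"): `M^×_TM = κ(O^×)` as subsets of the
ambient module. [cite: Mochizuki2012, Prop 3.1 (ii) p.88] -/
theorem units_coe_eq_image_isUnit (hinj : Function.Injective κ)
    (hrange : MonoidHom.mrange κ = E.constants) : (E.units : Set E.H) = κ '' {x : O | IsUnit x} := by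
  ext u
  constructor
  · intro hu
    have hu' : u ∈ E.constantMonoid := units_le_constantMonoid E hu
    change u ∈ E.constants at hu'
    rw [← hrange] at hu'
    obtain ⟨x, rfl⟩ := hu'
    exact ⟨x, (kummer_mem_units_iff E κ hinj hrange x).mp hu, rfl⟩
  · rintro ⟨x, hx, rfl⟩
    exact (kummer_mem_units_iff E κ hinj hrange x).mpr hx

/-- ASSEMBLY, **IUTchII:Prop3.1(i)**/(ii) (kurims pp.87–88): `Prop31Statements` HOLDS for input data
in which the constant monoid is the image of an equivariant Kummer embedding (this file), the action
permutes the `θ^ι_env`, and a divisor map kills the units and is positive on the `∞θ^ι_env` (first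
companion) — the first companion's `prop31Statements_of_val` with its stability HYPOTHESIS `hcns`
replaced by the printed mechanism of (ii). [cite: Mochizuki2012, Prop 3.1 p.87] -/
theorem prop31Statements_of_kummer {Γ : Type w'} [CommMonoid Γ] [PartialOrder Γ] [IsOrderedMonoid Γ]
    (hrange : MonoidHom.mrange κ = E.constants)
    (hequiv : ∀ (g : P) (x : O), κ (ρ g x) = E.conj g (κ x))
    (hperm : ∀ (g : P) (ι : E.Iota), ∃ ι' : E.Iota, E.conj g '' E.thetaEnv ι = E.thetaEnv ι')
    (v : E.H →* Γ) (hU : ∀ u ∈ E.units, v u = 1)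
    (hpos : ∀ (ι : E.Iota), ∀ t ∈ E.inftyThetaEnv ι, 1 < v t) : Prop31Statements E :=
  prop31Statements_of_val E (constants_stable_of_equivariant_mrange E ρ κ hrange hequiv) hperm v hU hpos

/-! #### Transport along an isomorphism of ambient modules (cyclotomic rigidity, Cors 2.8 (i), 2.9) -/

variable {H₀ : Type w'} [CommGroup H₀] (ρ₀ : P →* MulAut H₀) (κ₀ : O →* H₀) (φ : H₀ ≃* E.H)

/-- **IUTchII:Prop3.1(ii)** (kurims p.88) "By applying the cyclotomic rigidity isomorphisms of
Corollaries 2.8, (i); 2.9 …": if the Kummer embedding `κ₀ : O →* H₀` into the module with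
coefficients `μ_Ẑ(G_v)` is equivariant and `φ : H₀ ⥲ H` is an EQUIVARIANT isomorphism of ambient
modules (induced by an isomorphism of coefficient cyclotomes), then the composite `φ ∘ κ₀` is again an
equivariant embedding; so stability of `Ψ_cns := φ(κ₀(O))` follows.
[cite: Mochizuki2012, Prop 3.1 (ii) p.88] -/
theorem constants_stable_transport (hrange : MonoidHom.mrange (φ.toMonoidHom.comp κ₀) = E.constants)
    (hequiv₀ : ∀ (g : P) (x : O), κ₀ (ρ g x) = ρ₀ g (κ₀ x))
    (hφ : ∀ (g : P) (y : H₀), φ (ρ₀ g y) = E.conj g (φ y)) : E.IsConjStable E.constantMonoid :=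
  constants_stable_of_equivariant_mrange E ρ (φ.toMonoidHom.comp κ₀) hrange fun g x => by
    simp [hequiv₀ g x, hφ g]

/-- **IUTchII:Prop3.1(ii)** (kurims p.88), transported form of `exists_constantMonoid_mulEquiv`: with
`κ₀` injective and `φ` an equivariant isomorphism of ambient modules, `O ⥲ Ψ_cns` naturally
(= `φ ∘ κ₀` on elements) and equivariantly. [cite: Mochizuki2012, Prop 3.1 (ii) p.88] -/
theorem exists_constantMonoid_mulEquiv_transport (hinj : Function.Injective κ₀)
    (hrange : MonoidHom.mrange (φ.toMonoidHom.comp κ₀) = E.constants)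
    (hequiv₀ : ∀ (g : P) (x : O), κ₀ (ρ g x) = ρ₀ g (κ₀ x))
    (hφ : ∀ (g : P) (y : H₀), φ (ρ₀ g y) = E.conj g (φ y)) :
    ∃ e : O ≃* E.constantMonoid,
      (∀ x : O, ((e x : E.constantMonoid) : E.H) = φ (κ₀ x)) ∧
        ∀ (g : P) (x : O),
          ((e (ρ g x) : E.constantMonoid) : E.H) = E.conj g ((e x : E.constantMonoid) : E.H) := by
  obtain ⟨e, he⟩ :=
    exists_constantMonoid_mulEquiv E (φ.toMonoidHom.comp κ₀) (φ.injective.comp hinj) hrange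
  refine ⟨e, fun x => he x, fun g x => ?_⟩
  exact constantMonoid_mulEquiv_equivariant E ρ (φ.toMonoidHom.comp κ₀)
    (fun g x => by simp [hequiv₀ g x, hφ g]) e he g x

end KummerImage

end TemperedThetaMonoids

end Literature.IUT.HodgeArakelov
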